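import Summits.Parity.GeneralizedHardyLittlewood.Theses.ParityWeightedChenSwitching

/-!
# Line `birth` — BC3 skeleton for the crux `ParityChenInequality` (stmt-Parity-18666)

Route `ParityWeightedChenSwitching` (`route-Parity-ParityWeightedChenSwitching`, sub-problem
`GeneralizedHardyLittlewood`), crux decl
`Summit.Parity.GeneralizedHardyLittlewood.Theses.ParityWeightedChenSwitching.ParityChenInequality`
(rank 5, binder `h₃` of the deciding theorem `closes`; S1 of the route header, theorem-grade, difficulty L).
Registered by the skeleton registrar `planner-skel-stmt-Parity-18666-0` (2026-08-17; BC3 of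
`run/shared/lean/lens3/_common/BC.md`). The five stub NAMES and SIGNATURES below are byte-identical to the
ones already on the item record (planner `planner-type-cb86987b2c-0`, vetted PASS by
`refuter-skel-stmt-Parity-18666-vet-0`, paper-checked in `Cruxes/ParityChenInequality/Disproof.lean` §5);
this file supplies the tree copy `Lines/birth.lean` that the earlier seat could not write (one-writer rule).

## The crux (FIXED; verbatim the route decl)

`ParityChenInequality`:
`∃ c > 0, ∃ C, ∀ᶠ x : ℕ, c·x/log²x − C·(E₁ x + E₂ x) ≤ π₂(x)`, where
`E₁ x = Σ_{1 ≤ m ≤ x^0.499} |Σ_{p ≤ x prime, m ∣ p+2} μ(p+2)|` (literally the K1 sum),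
`E₂ x = Σ_{1 ≤ m ≤ x^0.499} |Σ_{e ∈ chenSetB x, m ∣ e} μ(e)|` (literally the K2 sum) and
`π₂(x) = #{p ≤ x : p, p+2 prime}`.

## The cut — Chen's chain with the PARITY WEIGHT `u = (1 − μ)/2`

Put the non-negative weight `u(n) = (1 − μ(n))/2 ∈ {0, ½, 1}` on the twin sequence
`𝒜(x) = {p + 2 : 2 < p ≤ x}` (`twinSieveSet x`) and on Chen's switched host `B(x)` (`chenSetB x`), with
`z = x^{1/8}` (`twinZ`), `y = (x+3)^{1/3}` (`twinY`) as in the tree's `ChenTwin`. On a squarefree `z`-rough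
survivor of Chen's weighted inequality `1 − ½ρ₁(n) − ½ρ₂(n) > 0` forces `Ω(n) ≤ 2`, and `u(n) = 0` when
`Ω(n) = 2` (μ = +1), `u(n) = 1` when `n` is prime: the u-weighted Chen count sees ONLY the twin primes.
The u-weighted sequences are sieve sequences of size `X/2`, density `1/φ`, and remainder
`R^u_d = ½ r_d − ½ M_d` with `M_d` exactly the inner sums of K1/K2 — so the tree's Iwaniec/Bombieri–Vinogradov
machinery (`Iwaniec1980_thm1_lower_of_half_lt`, `BombieriVinogradovStatement_holds`, `chenRemainderExt_bound`)
gives the three estimates with HALVED main terms and the twisted remainders absorbed into `E₁/2`, `E₂/2`: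

* `stub_chenWeighted` — the weighted-sieve inequality with parity weight (combinatorial, every `x ≥ 256`):
  `Φ₁ − ½Φ₂ − ½Φ₃ − y/2 − 2(x+2)/(z−1) ≤ π₂(x)`.
* `stub_lowerA` — (A)ᵘ: `Φ₁ ≥ (A₁ − ε)·XV − E₁/2`, `A₁ = e^γ log(2.992)/3.992` (= `f` of the linear sieve at
  `s = 8·0.499`, level `0.499`).
* `stub_upperSum` — (B)ᵘ: `Φ₂ ≤ (A₂ + ε)·XV + E₁/2`,
  `A₂ = (e^γ/(8·0.499))·(log((1/3)/(0.499−1/3)) − log((1/8)/(0.499−1/8)))`.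
* `stub_upperB` — (C)ᵘ: `Φ₃ ≤ (A₃ + ε)·XV + E₂/2`, `A₃ = c_sw·e^γ/(4·0.998)` (switching, level `0.499` for `B`).
* `stub_numerics` — `κ := A₁ − A₂/2 − A₃/2 > 0` (closed form; `e^γ` factors out; true with the tree majorant
  `switchingConstant ≤ integral_switchingMajorant ≈ 0.371654`, margin `+0.003147·e^γ`; NOT with
  `switchingIntegral_lt` alone).
* `ParityChenInequality_of` — the kernel-checked composition (ε := κ/4, `c := 4κe⁻⁷`, `C := 1`), exactly the
  tree's `chen_lowerBound_of_sieveEstimates` with halved constants: `XV ≥ 16e⁻⁷ x/log²x` (`twinMainTerm_ge`),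
  junk `y/2 + 2(x+2)/(z−1) ≤ 12 x^{7/8} ≤ 4κe⁻⁷ x/log²x` (`twin_errorTerms_le`, `eventually_twin_errorTerms_le`).

Here `XV = twinMainTerm x = (x/log x)·∏_{2<p<x^{1/8}} (1 − 1/(p−1))`,
`Φ₁ = Σ_{n ∈ 𝒜(x), z-rough} u(n)`, `Φ₂ = Σ_{z ≤ q < y prime} Σ_{n ∈ 𝒜(x), q ∣ n, z-rough} u(n)`,
`Φ₃ = Σ_{e ∈ B(x), y-rough} u(e)` (`phi1`, `phi2`, `phi3` below), `E1`, `E2`, `pi2` the crux's own sub-terms.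

Why the stubs are genuine (BC3): `stub_chenWeighted` is a pointwise combinatorial inequality with no main
term; (A)ᵘ/(B)ᵘ/(C)ᵘ are one-sided sieve bounds for three DIFFERENT weighted counts, none of which mentions
`π₂`; `stub_numerics` is a closed real inequality. No stub gives the crux or `GeneralizedHardyLittlewood`
cheaply (probes `bc/probes_crux.lean`, `bc/probes_summit.lean`: `first | exact? | simpa | aesop` FAIL, 10/10).
Disproof used: `Cruxes/ParityChenInequality/Disproof.lean` has NO `_false_without_` theorem and no `Negative/`
lemma (the crux has no hypotheses; it is sandwiched `TwinLowerDensity → S1`, `BigE → S1`); its §5 paper check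
of exactly these five signatures found none false; honoured: `stub_numerics` is stated with the exact
`switchingConstant` (to be bounded by `switchingIntegrand_le`/`integral_switchingMajorant`, not by
`switchingIntegral_lt`, which is too weak by `0.0011·e^γ`). Negatives index (`ledger negatives --problem
Parity`): no stub is an instance of a refuted statement (none concerns u-weighted Chen counts).
`sorry` occurs ONLY in the five `stub_*` theorems.
-/

noncomputable section

namespace Summit.Parity.GeneralizedHardyLittlewood.Cruxes.ParityChenInequality.Birth

-- the route file's own `open` context (so that the verbatim copies below elaborate to the crux's terms)
open scoped BigOperators Topology Classical
open Filter
open Literature.NumberTheory.Sieve.Chen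
open Literature.NumberTheory.Sieve.ChenSieve (IsRough primesIco)
open Summit.Parity.GeneralizedHardyLittlewood.Theses.ParityWeightedChenSwitching (ParityChenInequality)

/-! ### Vocabulary (local abbreviations; the stub signatures are stated over them) -/

/-- The parity weight `u(n) = (1 − μ(n))/2` (`= 1` on primes and on non-squarefree `n`, `= 0` on squarefree
`n` with an even number of prime factors, in particular on `P₂ ∖ primes ∖ squares`). [this line] -/
def parityWeight (n : ℕ) : ℝ := (1 - (ArithmeticFunction.moebius n : ℝ)) / 2

/-- `Φ₁(x) = S^u(𝒜(x), z)`: the u-weighted count of `z`-rough elements of the twin sequence. [this line] -/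
def phi1 (x : ℕ) : ℝ :=
  ∑ n ∈ (twinSieveSet x).filter (fun n => IsRough (twinZ x) n), parityWeight n

/-- `Φ₂(x) = Σ_{z ≤ q < y prime} S^u(𝒜(x)_q, z)`. [this line] -/
def phi2 (x : ℕ) : ℝ :=
  ∑ q ∈ primesIco (twinZ x) (twinY x),
    ∑ n ∈ (twinSieveSet x).filter (fun n => q ∣ n ∧ IsRough (twinZ x) n), parityWeight n

/-- `Φ₃(x) = S^u(B(x), y)`: the u-weighted count of `y`-rough elements of Chen's switched host. [this line] -/
def phi3 (x : ℕ) : ℝ :=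
  ∑ e ∈ (chenSetB x).filter (fun e => IsRough (twinY x) e), parityWeight e

/-- `E₁(x)`: literally the K1 sum of the crux. [this route] -/
def E1 (x : ℕ) : ℝ :=
  ∑ m ∈ Finset.Icc 1 ⌊(x : ℝ) ^ (0.499 : ℝ)⌋₊,
    |∑ p ∈ (Nat.primesLE x).filter (fun p => m ∣ p + 2), (ArithmeticFunction.moebius (p + 2) : ℝ)|

/-- `E₂(x)`: literally the K2 sum of the crux. [this route] -/
def E2 (x : ℕ) : ℝ :=
  ∑ m ∈ Finset.Icc 1 ⌊(x : ℝ) ^ (0.499 : ℝ)⌋₊,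
    |∑ e ∈ (Literature.NumberTheory.Sieve.Chen.chenSetB x).filter (fun e => m ∣ e),
      (ArithmeticFunction.moebius e : ℝ)|

/-- `π₂(x) = #{p ≤ x : p, p + 2 prime}` as typed in the crux. [this route] -/
def pi2 (x : ℕ) : ℝ :=
  (((Finset.range (x + 1)).filter (fun p => p.Prime ∧ (p + 2).Prime)).card : ℝ)

theorem E1_nonneg (x : ℕ) : 0 ≤ E1 x := Finset.sum_nonneg fun _ _ => abs_nonneg _
theorem E2_nonneg (x : ℕ) : 0 ≤ E2 x := Finset.sum_nonneg fun _ _ => abs_nonneg _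

/-- Unfolding: the crux in `E1/E2/pi2` vocabulary (definitional). [this route] -/
theorem parityChen_iff :
    ParityChenInequality ↔ ∃ c : ℝ, 0 < c ∧ ∃ C : ℝ, ∀ᶠ x : ℕ in atTop,
      c * (x : ℝ) / Real.log x ^ 2 - C * (E1 x + E2 x) ≤ pi2 x := Iff.rfl

/-! ### The five registered stubs (names and signatures = the item record) -/

/-- **Stub 1 — Chen's weighted-sieve inequality with the parity weight** (pointwise, every `x ≥ 256`):
`Φ₁(x) − ½Φ₂(x) − ½Φ₃(x) − y/2 − 2(x+2)/(z−1) ≤ π₂(x)`.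
Why plausibly true: the tree's `weightedSieve'` argument (Nathanson Thm 10.3 / (10.5)) run with the extra
factor `u(n) ∈ [0,1]`: on squarefree `z`-rough `n ∈ 𝒜(x)` with `Ω(n) ≥ 3` Chen's weight is `≤ 0`; the
squareful ones cost `≤ (x+2)/(z−1)` each for `𝒜` and for the host side (whence the factor 2); on squarefree
`Ω(n) = 2` survivors `u(n) = 0`, on primes `u = 1`, so the weighted count is `≤ #{p+2 prime} ≤ π₂(x)`; the
triple count is switched to `B(x)` exactly as in `tripleCount_twin_le` (`u ≡ 1` on `p₁p₂p₃`? no — the bound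
goes through `#{e ∈ B prime-like, y-rough}` where `u ≤ 1`, and `y/2` absorbs the `p₁² ∣ n` terms).
Why it might fail: only bookkeeping (the `u`-weight must be threaded through the `(q, n) ↦` double count and
the switching injection with the SAME roughness filters as `phi2`/`phi3`). Size: M.
Leans on: `Literature.NumberTheory.Sieve.ChenSieve.weightedSieve'`, `weight_le_indicator'`, `squareCount_le`,
`Literature.NumberTheory.Sieve.Chen.tripleCount_twin_le`, `two_le_twinZ` (tree, proved).
Sources: Nathanson1996 Thm 10.3, ChenSciSinica1973. -/
theorem stub_chenWeighted : ∀ x : ℕ, 256 ≤ x → phi1 x - phi2 x / 2 - phi3 x / 2 - (twinY x : ℝ) / 2 - 2 * (((x : ℝ) + 2) / ((twinZ x : ℝ) - 1)) ≤ pi2 x := by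
  sorry

/-- **Stub 2 — (A)ᵘ, the lower linear sieve for the u-weighted twin sequence at level `0.499`:**
for every `ε > 0`, eventually `Φ₁(x) ≥ (e^γ·log(2.992)/3.992 − ε)·XV − E₁(x)/2`.
Why plausibly true: `aᵘ_n = u(n)·1_{𝒜(x)}(n) ≥ 0` is a `SieveSequence` with `X = li-type/2`, `g(d) = 1/φ(d)`
and remainder `rᵘ_d = ½ r_d(𝒜) − ½ M_d`, `M_d = Σ_{p ≤ x, d ∣ p+2} μ(p+2)` (the K1 inner sum; `p = 2` gives
`μ(4) = 0`); Iwaniec's lower bound (`Iwaniec1980_thm1_lower_of_half_lt`, PROVED in-tree) with `D = x^{0.499}`,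
`s = log D/log z = 3.992`, `f(s) = 2e^γ log(s−1)/s`, Bombieri–Vinogradov for `Σ_d |r_d|`
(`BombieriVinogradovStatement_holds`) and `Σ_{d ≤ D} |M_d| ≤ E₁`; the halved main term is `A₁·XV`.
Why it might fail: bookkeeping only — the remainder sum runs over `d ∣ P(z)`, `d ≤ D`, a SUBSET of the
moduli `1 ≤ m ≤ x^0.499` of `E₁` (needs `|·|`-monotonicity, fine), and the `o(XV)` losses of the
fundamental-lemma/Mertens normalisation must fit in `ε·XV`. Size: L.
Leans on: `Literature.NumberTheory.Sieve.Chen.twinMainTerm`, `twinSieveSet`, `Iwaniec1980_thm1_lower_of_half_lt`,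
`BombieriVinogradovStatement_holds`, `twin_sieveLower_holds` pattern (tree). Sources: Iwaniec1980,
HalberstamRichert1974 Thm 8.4, Nathanson1996 Thm 10.4. -/
theorem stub_lowerA : ∀ ε : ℝ, 0 < ε → ∀ᶠ x : ℕ in atTop, (Real.exp Real.eulerMascheroniConstant * (Real.log 2.992 / 3.992) - ε) * twinMainTerm x - E1 x / 2 ≤ phi1 x := by
  sorry

/-- **Stub 3 — (B)ᵘ, the upper linear sieve summed over `z ≤ q < y` for the u-weighted twin sequence:**
for every `ε > 0`, eventually
`Φ₂(x) ≤ ((e^γ/(8·0.499))·(log((1/3)/(0.499−1/3)) − log((1/8)/(0.499−1/8))) + ε)·XV + E₁(x)/2`.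
Why plausibly true: for each prime `q ∈ [z, y)` sieve `(aᵘ)_q` to level `D/q` with `F(s_q)`,
`s_q = log(D/q)/log z`; the twisted remainders `M_{qd}` are injected by `(q, d) ↦ qd ≤ D` (`q` is the unique
prime factor of `qd` in `[z, y)` since `d ∣ P(z)`), so their total is `≤ ½ Σ_{m ≤ x^0.499} |M_m| = E₁/2`;
the sum over `q` of `F(s_q)/φ(q)` is the stated integral `(e^γ/(8ϑ))·log((8ϑ−1)(… ))`, `ϑ = 0.499`, by
Mertens — verbatim the tree's `twin_sieveUpperSum` analysis with weights.
Why it might fail: bookkeeping only (injectivity of `(q,d) ↦ qd` needs `d ∣ P(z)`; uniformity of the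
`F`-bound in `q`; prime-sum-to-integral with error `ε·XV`). Size: L.
Leans on: `Iwaniec1980_thm1_upper` instance in-tree, `primesIco`, `twin_sieveUpperSum_holds` pattern,
`BombieriVinogradovStatement_holds`. Sources: Iwaniec1980, Nathanson1996 Thm 10.5, HalberstamRichert1974. -/
theorem stub_upperSum : ∀ ε : ℝ, 0 < ε → ∀ᶠ x : ℕ in atTop, phi2 x ≤ (Real.exp Real.eulerMascheroniConstant * ((Real.log ((1 / 3) / (0.499 - 1 / 3)) - Real.log ((1 / 8) / (0.499 - 1 / 8))) / 0.499) / 8 + ε) * twinMainTerm x + E1 x / 2 := by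
  sorry

/-- **Stub 4 — (C)ᵘ, the upper sieve for the u-weighted switched host at level `0.499`:**
for every `ε > 0`, eventually `Φ₃(x) ≤ (c_sw·e^γ/(4·0.998) + ε)·XV + E₂(x)/2`.
Why plausibly true: `bᵘ_e = u(e)·1_{B(x)}(e) ≥ 0` has size `½·#B`, density `1/φ`, remainder
`½ r_d(B) − ½ M'_d` with `M'_d = Σ_{e ∈ B, d ∣ e} μ(e)` (the K2 inner sum); the untwisted level-`(1/2−δ)`
distribution of `B` is PROVED in-tree (`chenRemainderExt_bound`), the upper sieve at `s = 8·0.499·(…)` with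
`F(s) = 2e^γ/s` and the prime-number-theorem evaluation `#B ~ c_sw·x/log x` (`switchingConstant`) give the
halved constant `A₃ = c_sw e^γ/(8·0.499)`.
Why it might fail: bookkeeping only (the remainder moduli `d ∣ P(y)`, `d ≤ x^0.499` sit inside `E₂`'s range;
`#B` asymptotic with error `ε·XV`). Size: L.
Leans on: `Literature.NumberTheory.Sieve.Chen.chenSetB`, `chenRemainderExt_bound`, `switchingConstant`,
`twin_sieveUpperB_holds` pattern (tree). Sources: ChenSciSinica1973, Nathanson1996 Thm 10.6, Wu2004. -/
theorem stub_upperB : ∀ ε : ℝ, 0 < ε → ∀ᶠ x : ℕ in atTop, phi3 x ≤ (switchingConstant * Real.exp Real.eulerMascheroniConstant / (4 * 0.998) + ε) * twinMainTerm x + E2 x / 2 := by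
  sorry

/-- **Stub 5 — the numerical margin** `κ = A₁ − A₂/2 − A₃/2 > 0`, i.e.
`e^γ·(0.274535 − 0.224838 − 0.125251·c_sw) > 0`, i.e. `c_sw < 0.39678`.
Why plausibly true: `switchingConstant = ∫_{1/8}^{1/3} log(2−3β)/(β(1−β)) dβ = 0.363084…`; the tree proves
`switchingConstant ≤ integral_switchingMajorant = 495/1152 + 15/16 + (5/6)log(8/3) − (20/3)log(21/16)
≈ 0.371654` (`switchingIntegrand_le`, `integral_switchingMajorant`), leaving margin `+0.003147·e^γ`
(independently re-verified by the disprover, Simpson `n = 2·10⁵`). NOTE: `switchingIntegral_lt` alone is too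
weak (margin `−0.0011·e^γ`). Then `e^γ > 0` factors out and the rest is `Real.log` arithmetic
(`Real.log_lt_sub_one_of_pos`-type rational bounds on `log 2.992`, `log(8/3)`, `log(21/16)`, …).
Why it might fail: it cannot if the quoted decimal evaluations are right (three independent evaluations
agree); the risk is only proof-engineering of tight `log` bounds. Size: M.
Leans on: `Literature.NumberTheory.Sieve.Chen.switchingIntegrand_le`, `integral_switchingMajorant`,
`log_three_halves_gt`, `log_seven_fourths_gt` (tree); Mathlib `Real.exp_pos`, `Real.log_le_sub_one_of_pos`,
`Real.add_pow_le_pow_mul_pow_of_sq_le_sq`-free elementary bounds. Sources: Nathanson1996 §10.8, Wu2004. -/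
theorem stub_numerics : 0 < Real.exp Real.eulerMascheroniConstant * (Real.log 2.992 / 3.992) - (Real.exp Real.eulerMascheroniConstant * ((Real.log ((1 / 3) / (0.499 - 1 / 3)) - Real.log ((1 / 8) / (0.499 - 1 / 8))) / 0.499) / 8) / 2 - (switchingConstant * Real.exp Real.eulerMascheroniConstant / (4 * 0.998)) / 2 := by
  sorry

/-! ### Legend: the stub statements as named propositions (binders of the hypothetical composition) -/

/-- `Sig.stub_chenWeighted` := the statement of `stub_chenWeighted`, verbatim. [this line] -/
def Sig.stub_chenWeighted : Prop :=
  ∀ x : ℕ, 256 ≤ x → phi1 x - phi2 x / 2 - phi3 x / 2 - (twinY x : ℝ) / 2 - 2 * (((x : ℝ) + 2) / ((twinZ x : ℝ) - 1)) ≤ pi2 x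

/-- `Sig.stub_lowerA` := the statement of `stub_lowerA`, verbatim. [this line] -/
def Sig.stub_lowerA : Prop :=
  ∀ ε : ℝ, 0 < ε → ∀ᶠ x : ℕ in atTop, (Real.exp Real.eulerMascheroniConstant * (Real.log 2.992 / 3.992) - ε) * twinMainTerm x - E1 x / 2 ≤ phi1 x

/-- `Sig.stub_upperSum` := the statement of `stub_upperSum`, verbatim. [this line] -/
def Sig.stub_upperSum : Prop :=
  ∀ ε : ℝ, 0 < ε → ∀ᶠ x : ℕ in atTop, phi2 x ≤ (Real.exp Real.eulerMascheroniConstant * ((Real.log ((1 / 3) / (0.499 - 1 / 3)) - Real.log ((1 / 8) / (0.499 - 1 / 8))) / 0.499) / 8 + ε) * twinMainTerm x + E1 x / 2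

/-- `Sig.stub_upperB` := the statement of `stub_upperB`, verbatim. [this line] -/
def Sig.stub_upperB : Prop :=
  ∀ ε : ℝ, 0 < ε → ∀ᶠ x : ℕ in atTop, phi3 x ≤ (switchingConstant * Real.exp Real.eulerMascheroniConstant / (4 * 0.998) + ε) * twinMainTerm x + E2 x / 2

/-- `Sig.stub_numerics` := the statement of `stub_numerics`, verbatim. [this line] -/
def Sig.stub_numerics : Prop :=
  0 < Real.exp Real.eulerMascheroniConstant * (Real.log 2.992 / 3.992) - (Real.exp Real.eulerMascheroniConstant * ((Real.log ((1 / 3) / (0.499 - 1 / 3)) - Real.log ((1 / 8) / (0.499 - 1 / 8))) / 0.499) / 8) / 2 - (switchingConstant * Real.exp Real.eulerMascheroniConstant / (4 * 0.998)) / 2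

/-! ### Composition (kernel-checked; `sorry` enters only through the five `stub_*`) -/

/-- **THE SKELETON THEOREM** — the crux
`Summit.Parity.GeneralizedHardyLittlewood.Theses.ParityWeightedChenSwitching.ParityChenInequality` BY NAME from
the five stub STATEMENTS: with `κ := A₁ − A₂/2 − A₃/2 > 0` (stub 5) and `ε := κ/4` in stubs 2–4, stub 1 gives
`π₂ ≥ (κ/2)·XV − ¾E₁ − ¼E₂ − junk`; `XV ≥ 16e⁻⁷x/log²x` (`twinMainTerm_ge`) and
`junk ≤ 12x^{7/8} ≤ 4κe⁻⁷x/log²x` (`twin_errorTerms_le`, `eventually_twin_errorTerms_le`), so the crux holds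
with `c = 4κe⁻⁷`, `C = 1`. No `sorry` of its own. [this line] -/
theorem ParityChenInequality_of :
    Sig.stub_chenWeighted → Sig.stub_lowerA → Sig.stub_upperSum → Sig.stub_upperB → Sig.stub_numerics →
      Summit.Parity.GeneralizedHardyLittlewood.Theses.ParityWeightedChenSwitching.ParityChenInequality := by
  intro h1 h2 h3 h4 h5
  dsimp only [Sig.stub_chenWeighted, Sig.stub_lowerA, Sig.stub_upperSum, Sig.stub_upperB,
    Sig.stub_numerics] at h1 h2 h3 h4 h5
  rw [parityChen_iff]
  -- the three sieve constants and the margin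
  set A₁ : ℝ := Real.exp Real.eulerMascheroniConstant * (Real.log 2.992 / 3.992) with hA₁
  set A₂ : ℝ := Real.exp Real.eulerMascheroniConstant *
      ((Real.log ((1 / 3) / (0.499 - 1 / 3)) - Real.log ((1 / 8) / (0.499 - 1 / 8))) / 0.499) / 8 with hA₂
  set A₃ : ℝ := switchingConstant * Real.exp Real.eulerMascheroniConstant / (4 * 0.998) with hA₃
  set κ : ℝ := A₁ - A₂ / 2 - A₃ / 2 with hκ
  have hκpos : 0 < κ := h5
  have hε : 0 < κ / 4 := by positivity
  refine ⟨4 * κ * Real.exp (-7), by positivity, 1, ?_⟩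
  filter_upwards [h2 _ hε, h3 _ hε, h4 _ hε, eventually_ge_atTop 6561,
    eventually_twin_errorTerms_le (show 0 < 2 * κ * Real.exp (-7) by positivity)] with x hAx hBx hCx hx hjunk
  have hW := h1 x (by omega)
  have hM := twinMainTerm_ge hx
  have hJ := twin_errorTerms_le (show 256 ≤ x by omega)
  have hE1 : 0 ≤ E1 x := E1_nonneg x
  have hE2 : 0 ≤ E2 x := E2_nonneg x
  have hy : (0 : ℝ) ≤ (twinY x : ℝ) / 2 := by positivity
  -- the main-term identity: `(A₁ − ε) − ½(A₂ + ε) − ½(A₃ + ε) = κ/2` at `ε = κ/4`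
  have hkey : (A₁ - κ / 4) * twinMainTerm x - (A₂ + κ / 4) * twinMainTerm x / 2 -
      (A₃ + κ / 4) * twinMainTerm x / 2 = κ / 2 * twinMainTerm x := by
    rw [hκ]; ring
  -- `linarith` treats a quotient by a non-numeral as an atom: isolate `L = x/(log x)²`
  set L := (x : ℝ) / Real.log x ^ 2 with hL
  have hM' : 16 * Real.exp (-7) * L ≤ twinMainTerm x := by
    rw [hL, show 16 * Real.exp (-7) * ((x : ℝ) / Real.log x ^ 2) =
      16 * Real.exp (-7) * x / Real.log x ^ 2 by ring]
    exact hM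
  have hjunk' : 6 * (x : ℝ) ^ (7 / 8 : ℝ) ≤ 2 * κ * Real.exp (-7) * L := by
    rw [hL, show 2 * κ * Real.exp (-7) * ((x : ℝ) / Real.log x ^ 2) =
      2 * κ * Real.exp (-7) * x / Real.log x ^ 2 by ring]
    exact hjunk
  rw [show 4 * κ * Real.exp (-7) * (x : ℝ) / Real.log x ^ 2 = 4 * κ * Real.exp (-7) * L by
    rw [hL]; ring]
  have hmain : 8 * κ * Real.exp (-7) * L ≤ κ / 2 * twinMainTerm x :=
    calc 8 * κ * Real.exp (-7) * L = κ / 2 * (16 * Real.exp (-7) * L) := by ring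
      _ ≤ κ / 2 * twinMainTerm x := mul_le_mul_of_nonneg_left hM' (by positivity)
  -- junk: `y/2 + 2(x+2)/(z−1) ≤ 2·(y/2 + (x+2)/(z−1)) ≤ 12 x^{7/8} ≤ 4κe⁻⁷ L`
  have hJ2 : (twinY x : ℝ) / 2 + 2 * (((x : ℝ) + 2) / ((twinZ x : ℝ) - 1)) ≤ 4 * κ * Real.exp (-7) * L := by
    have hz : (2 : ℝ) ≤ (twinZ x : ℝ) := by exact_mod_cast two_le_twinZ (show 2 ≤ x by omega)
    have hq : 0 ≤ ((x : ℝ) + 2) / ((twinZ x : ℝ) - 1) := div_nonneg (by positivity) (by linarith)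
    linarith
  linarith

/-- The crux by name, closed modulo the five registered stubs (checks that the `Sig.*` legend is
definitionally the stub statements). [this line] -/
theorem parityChenInequality_of_stubs :
    Summit.Parity.GeneralizedHardyLittlewood.Theses.ParityWeightedChenSwitching.ParityChenInequality :=
  ParityChenInequality_of stub_chenWeighted stub_lowerA stub_upperSum stub_upperB stub_numerics

-- audit: the conclusion is the route decl itself
#check (ParityChenInequality_of : Sig.stub_chenWeighted → Sig.stub_lowerA → Sig.stub_upperSum →
  Sig.stub_upperB → Sig.stub_numerics →
  Summit.Parity.GeneralizedHardyLittlewood.Theses.ParityWeightedChenSwitching.ParityChenInequality)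

end Summit.Parity.GeneralizedHardyLittlewood.Cruxes.ParityChenInequality.Birth

end
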